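import Mathlib
import Summits.NavierStokesRegularity.NavierStokesRegularity.Theses.EulerZoomLiouville
import Summits.NavierStokesRegularity.NavierStokesRegularity.Theorems.EulerZoomLiouvillePowerGaugeEulerLiouvilleLargeRho
import Summits.NavierStokesRegularity.NavierStokesRegularity.Theorems.EulerZoomLiouvillePowerGaugeEulerLiouvillePastIrrotational
import Summits.NavierStokesRegularity.NavierStokesRegularity.Theorems.EulerZoomLiouvillePowerGaugeEulerLiouvilleAnchoredBudgetLocalFloor
import Summits.NavierStokesRegularity.NavierStokesRegularity.Theorems.EulerZoomLiouvillePowerGaugeEulerLiouvilleAnchoredBudgetStarvation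
import Summits.NavierStokesRegularity.NavierStokesRegularity.Theorems.EulerZoomLiouvillePowerGaugeEulerLiouvilleAnchoredBudgetStratumRev3
import Literature.Analysis.FluidPDE.ClassicalSolution
import Literature.Analysis.FluidPDE.VectorCalculus
import HarnessLib.Audit

/-!
# Line `anchored-budget` (ideator ns-idea-11 g4, lens «complete» = program-completion) for the crux
# `EulerZoomLiouville.PowerGaugeEulerLiouville` (stmt-NavierStokesRegularity-19832)

PROGRAMME COMPLETED.  Every Lagrangian stratum filed on this crux so far (the lead's `KelvinPhysical`/`FadingPast` fillers, the seat's
`casimir-floor`, `swirl-capacity`, `stretching-budget`, `helicity-tube`) CONFINES material objects by a POINTWISE VELOCITY ENVELOPE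
`‖u(τ)‖_∞ ≤ M(−τ)^{−κ}` — the critic's census (V34): «none touches the non-drifting members».  The regular-Lagrangian-flow literature
has the tool that removes the envelope: the NO-ESCAPE (compressibility) estimate of Crippa–De Lellis [doi:10.1515/crelle.2008.016, §2–3]
— the measure of the labels of a material set that travel far is paid by an INTEGRAL norm of the velocity over the region they cross, not
by `‖u‖_∞`.  In the power-gauged class that integral norm is paid by the GAUGES THEMSELVES: on a set `E ⊆ B(0,a)` of blob size,
`∫_E |u(s)| ≤ |E|^{5/6} ‖ψ_{a} u(s)‖_{L⁶} ≤ |E|^{5/6} C_GNS ‖∇(ψ_a u(s))‖_{L²}` (Gagliardo–Nirenberg–Sobolev, Mathlib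
`MeasureTheory.eLpNorm_le_eLpNorm_fderiv_of_eq`, `p = 2 < n = 3`, `p* = 6`; `ψ_a` a cutoff of `B(0,a)` inside `B(0,2a)`), and in time the `E`-gauge
pays `∫‖∇u(s)‖_{L²(B_{2a})} ds ≤ S^{1/2} (c (2a)^{1−ρ})^{1/2}` while the `A`-gauge pays the cutoff term `a^{−1}‖u(s)‖_{L²(B_{2a})} ≤ C√c a^{−(1+2ρ)/2}`
(`BackwardTools.lintegral_ball_le_of_gaugeA`; it only FIXES THE FRAME — no Galilean drift).  Hence

  (i)  ANCHORED FLOOR TRANSPORT (C1 `stub_anchoredFloorTransport`, the new lemma, pure kinematics + Grönwall, LOCAL flow only): a late blob `B = B(x₀,δ) ⊆ B(0,a/2)` at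
       time `t₀`; going backward to `t₁`, a label that leaves `B(0,a)` has travelled `≥ a/2` INSIDE `B(0,a)`, so by Fubini + measure preservation the
       escaping labels have measure `≤ (∫_{t₁}^{t₀} Φ(s) ds)/(a/2)` whenever `∫_E |u(s)| ≤ Φ(s)` for every measurable `E ⊆ B(0,a)` with `|E| ≤ |B|`
       (an EVICTION BUDGET `Φ ≥ 0`, integrable); the remaining labels sit in `B(0,a)` at time `t₁` and carry the stretching-budget floor
       `|ω(t₁)|² ≥ w² e^{−2∫Λ}((−t₀)/(−t₁))^{2K}` of the sibling line (backward Grönwall on `D_σ|ω|² = 2α|ω|² ≤ 2(K/(−σ)+Λ)|ω|²`).  NO velocity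
       hypothesis enters.
  (ii) ANCHORED STARVATION (C2 `stub_anchoredStarvation`): with the GNS eviction budget above, `∫Φ ≤ (a/4)|B|` throughout the BULK WINDOW
       `t₁ ∈ (t₀ − S_a, t₀)`, `S_a = ε² |B|^{1/3} a^{1+ρ}/c` (`ε = ε(C_GNS)`; `S_a ≤ a²` for large `a`), so half the blob is anchored and
       `∫_{−a²}^{0}∫_{B(a)}|curl u|² ≳ S_a^{1−2K} ≍ a^{(1+ρ)(1−2K)}` against the `E`-gauge `≤ 16 c a^{1−ρ}` (`CasimirFloorEndgameTools.lintegral_window_sq_curl_le`):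
       contradiction as `a → ∞` iff `(1+ρ)(1−2K) > 1−ρ`, i.e. `K < K₂(ρ) := ρ/(1+ρ)` (`exponent_race` below) — NON-EMPTY FOR EVERY `ρ > 0`,
       `K₂(1/2) = 1/3`.  Hence `curl u ≡ 0` on `(−∞,T₁)` and the lead's LANDED `PastIrrotational.ae_eq_zero_of_gauge_of_pastIrrotational` concludes BY NAME.

THE STRATUM `IsAnchoredBudgeted ρ` (rev3): CLASSICAL members — nothing more — whose far
past `(−∞,T₁)` carries a stretching budget `α⁺ ≤ K/(−τ) + Λ`, `Λ ≥ 0` integrable, `0 ≤ K < K₂(ρ) = ρ/(1+ρ)`.  NOTHING is assumed about the size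
of the velocity: the members may be INTERMITTENT / non-drifting (large velocity on thin sets, which is all the gauges allow at large scales).  This is
the first stratum on this crux outside the «velocity envelope» family.  LABEL HISTORY: rev0–rev2 carried a flow-owning clause (gradient bounded on compact
time sets, uniformly in `x`), whose price the critic recorded (V37 P1: with the A-gauge it forces sublinear SPATIAL growth `|u(τ,x)| ≲ (L³c)^{1/5}(1+|x|)^{(1−2ρ)/5}`).
rev3 DROPS THE CLAUSE: anchoring only ever follows labels inside the bounded ball `B(0,a)`, where a smooth field is uniformly Lipschitz on compact time sets
and its LOCAL flow is injective and measure-preserving; a trajectory that leaves every compact set, or ceases to exist, first crosses the sphere `‖x‖ = a` and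
is paid for by the eviction budget (C1 docstring).  So the stratum is «CLASSICAL + sub-threshold budget», and NOTHING bounds `u` or `∇u` pointwise — in
space or in time — beyond what the gauges allow (intermittent, spatially unbounded gradients included).  HONEST LABEL (critic V37b, 2026-08-28T11:20:22Z, verbatim):
«stratum grade — envelope-free and flow-clause-free; thin w.r.t. SS needle» (`K₂ ≤ 1/3 < 1 ≤ K_V`); V37 P1's derived growth label retired as moot; weak
(non-classical) members untouched.  Comparison with the sibling `stretching-budget` (threshold
`min((1+ρ)/4, (κ+ρ−κρ)/2)` under an envelope of exponent `κ`): anchoring is WEAKER than a sub-parabolic envelope (`K₂ < (1+ρ)/4`, `threshold_lt_envelope`)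
but STRONGER than any envelope with `κ < ρ/(1+ρ)` — in particular than BOUNDED VELOCITY (`κ = 0`: `ρ/2 < ρ/(1+ρ)`), because the GNS bulk window
`a^{1+ρ}` beats the drift window `a^{1/(1−κ)}` exactly when `κ < ρ/(1+ρ)` (`anchor_beats_drift_iff`).  `K = 0`: a classical member whose
vorticity modulus is (up to the integrable factor `e^{∫Λ}`) non-increasing forward along every far-past trajectory is trivial — for every `ρ ∈ (0,1/2]`.
Self-similar members have `K_V ≥ 1` (profile equation at a vorticity maximum; critic N38) and are correctly OUTSIDE.

RESIDUE `stub_anchoredRest` = members outside the stratum (weak = non-classical; or classical with positive stretching budget at `−∞` above `K₂/(−τ)` on every far past)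
— OPEN, crux-sized, NOT claimed.  Files only; nothing is wired into the LEAD's skeleton by this seat.
Crux 19832, rung N0 and NS regularity stay OPEN.  No summit is proved by a line.

REV5 — THE STRATUM THEOREM IS LANDED (2026-08-28; provers ns-sfl-p1 g3/g4 = C1, ns-ezl-w2 g2 = C2 + member; all `--supports stmt-19832 --as helper`,
std axioms): C1 `stub_anchoredFloorTransport := AnchoredBudget.anchoredFloorTransport_rev3` (p631965, the rev3 CLAUSE-FREE text, via the cutoff-field flow
`AnchoredBudget.cutoffFlow` p631088 + the one-curve floor/no-escape lemmas p630763) and C2 `stub_anchoredStarvation := AnchoredBudget.anchoredStarvation`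
(p629964; eviction budget p628775, bookkeeping p629339) are FILLED BY NAME below — this file's only `sorry` is now the residue C3; the composition
`PowerGaugeEulerLiouville_of_anchoredRest : Sig.stub_anchoredRest → crux` and the corollaries `anchoredBudget_K0`, `anchoredBudget_integrableLipschitz` are
UNCONDITIONAL (kernel-checked, no sorry in their cone); the tree's own statements of the same are `AnchoredBudget.anchoredBudgeted_ae_eq_zero_rev3`,
`…anchoredBudgeted_K0_ae_eq_zero_rev3`, `…integrableLipschitz_ae_eq_zero` (p632310), cited by name in `anchoredBudgeted_vanishes`.
-/

open MeasureTheory Set Filter Topology Metric Real InnerProductSpace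
open scoped ENNReal NNReal RealInnerProductSpace
open Literature.Analysis Literature.Analysis.FluidPDE

set_option linter.dupNamespace false

namespace Summit.NavierStokesRegularity.NavierStokesRegularity.Cruxes.PowerGaugeEulerLiouville.AnchoredBudget

/-- Local abbreviation: ℝ³. -/
abbrev E3 : Type := EuclideanSpace ℝ (Fin 3)

/-- Membership in Seregin's power-gauged ancient Euler class — verbatim the three hypotheses of the crux (same as `Birth.InClass`). -/
@[reducible] def InClass (ρ : ℝ) (u : ℝ → E3 → E3) (p : ℝ → E3 → ℝ) (H : ℝ → E3 → E3 →L[ℝ] E3)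
    (c : ℝ≥0) : Prop :=
  IsSuitableWeakSolutionOn (slab (EuclideanSpace ℝ (Fin 3)) (Set.Iio 0) isOpen_Iio) 0 0 u p ∧
    HasWeakSpatialGradientOn (slab (EuclideanSpace ℝ (Fin 3)) (Set.Iio 0) isOpen_Iio) u H ∧
    (∀ a : ℝ, 0 < a →
      ENNReal.ofReal (a ^ (2 * ρ)) * cknA a (0 : ℝ × E3) u + ENNReal.ofReal (a ^ ρ) * cknE a (0 : ℝ × E3) H +
        ENNReal.ofReal (a ^ (2 * ρ)) * cknD a (0 : ℝ × E3) p ≤ (c : ℝ≥0∞))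

/-- The conclusion of the crux: `u` vanishes a.e. on the past slab. -/
@[reducible] def VanishesAE (u : ℝ → E3 → E3) : Prop :=
  Function.uncurry u =ᵐ[volume.restrict (Set.Iio (0 : ℝ) ×ˢ (Set.univ : Set E3))] 0

/-- AN ANCHORABLE FAR PAST (rev3: NO FLOW CLAUSE): just a CLASSICAL member — jointly `C^∞` velocity and pressure solving Euler on `(−∞,0) × ℝ³` — and a time
`T₁ ≤ 0`.  Nothing else: NO velocity envelope in time, NO Lipschitz bound in space, no global particle flow assumed.  Anchoring needs only the LOCAL flow a
smooth field always has: labels are followed while their trajectory stays in the bounded ball `B(0,a)` (where `u` is uniformly Lipschitz on compact time sets,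
the flow is classical, injective and measure-preserving), and a trajectory can leave every compact set — or cease to exist — only after crossing the sphere
`‖x‖ = a`, which puts its label in the ESCAPE SET that the eviction budget pays for.  (rev0–rev2 carried the clause «gradient bounded on compact time sets
uniformly in `x`»; the critic's label V37 P1 recorded its price — sublinear spatial growth `|u(τ,x)| ≲ (L³c)^{1/5}(1+|x|)^{(1−2ρ)/5}`.  With the clause gone NOTHING
bounds `u` pointwise: the members may have intermittent, spatially unbounded gradient and velocity, as far as the gauges allow.) -/
def IsAnchorablePast (u : ℝ → E3 → E3) (p : ℝ → E3 → ℝ) (T₁ : ℝ) : Prop :=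
  IsClassicalEulerSolutionOn (Set.Iio 0) 0 u p ∧ T₁ ≤ 0

/-- A STRETCHING BUDGET `(K, Λ)` on the far past `(−∞,T₁)` (same predicate as the sibling line `stretching-budget`, restated — lines do not
share declarations): `Λ ≥ 0` integrable on `(−∞,T₁)` and `⟪∇u(τ,x) ω, ω⟫ ≤ (K/(−τ) + Λ(τ)) |ω|²`, `ω = curl u(τ,x)`. -/
def HasStretchingBudget (u : ℝ → E3 → E3) (T₁ K : ℝ) (Λ : ℝ → ℝ) : Prop :=
  IntegrableOn Λ (Set.Iio T₁) ∧ (∀ τ : ℝ, 0 ≤ Λ τ) ∧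
    ∀ τ : ℝ, τ < T₁ → ∀ x : E3,
      ⟪fderiv ℝ (u τ) x (curl (u τ) x), curl (u τ) x⟫ ≤ (K / (-τ) + Λ τ) * ‖curl (u τ) x‖ ^ 2

/-- The threshold of the BULK-WINDOW race (derived, not chosen): `K₂(ρ) = ρ/(1+ρ)` — the GNS window `S_a ≍ a^{1+ρ}` on which the gauges anchor half
of every blob, against the `E`-gauge `a^{1−ρ}`: `(1+ρ)(1−2K) > 1−ρ`.  Positive iff `ρ > 0`; `K₂(1/2) = 1/3`. -/
noncomputable def anchoredThreshold (ρ : ℝ) : ℝ :=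
  ρ / (1 + ρ)

/-- THE STRATUM (rev3): a CLASSICAL member whose far past carries a stretching budget below the bulk threshold.  No velocity hypothesis, no flow clause. -/
def IsAnchoredBudgeted (ρ : ℝ) (u : ℝ → E3 → E3) (p : ℝ → E3 → ℝ) : Prop :=
  ∃ T₁ K : ℝ, ∃ Λ : ℝ → ℝ,
    IsAnchorablePast u p T₁ ∧ 0 ≤ K ∧ K < anchoredThreshold ρ ∧ HasStretchingBudget u T₁ K Λ

/-- ANCHORED FLOOR BLOBS (the conclusion shape of C1): every late blob `B = B(x₀,δ) ⊆ B(0,a/2)` at a time `t₀ < T₁` on which `|curl u(t₀)| ≥ w ≥ 0`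
has, at every earlier time `t₁ < t₀` and for every EVICTION BUDGET `Φ ≥ 0` (integrable on `[t₁,t₀]`, with `∫_E |u(s)| ≤ Φ(s)` for all `s ∈ [t₁,t₀]` and all
measurable `E ⊆ B(0,a)` of volume `≤ |B|`), a measurable avatar `T ⊆ B(0,a)` with `|B| ≤ |T| + (∫_{[t₁,t₀]} Φ)/(a/2)` on which `|curl u(t₁)|² ≥ w² e^{−2∫_{(t₁,t₀)}Λ}
((−t₀)/(−t₁))^{2K}` (in truth `T` = backward flow image of the NON-ESCAPING labels of the blob; the loss term is the Crippa–De Lellis no-escape bound). -/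
def AnchoredFloorBlobs (u : ℝ → E3 → E3) (T₁ K : ℝ) (Λ : ℝ → ℝ) : Prop :=
  ∀ t₀ : ℝ, t₀ < T₁ → ∀ (x₀ : E3) (δ w a : ℝ) (Φ : ℝ → ℝ), 0 < δ → 0 ≤ w → 0 < a → ‖x₀‖ + δ ≤ a / 2 →
    (∀ x ∈ ball x₀ δ, w ≤ ‖curl (u t₀) x‖) →
    ∀ t₁ : ℝ, t₁ < t₀ → IntegrableOn Φ (Set.Icc t₁ t₀) → (∀ s ∈ Set.Icc t₁ t₀, 0 ≤ Φ s) →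
      (∀ s ∈ Set.Icc t₁ t₀, ∀ E : Set E3, MeasurableSet E → E ⊆ ball (0 : E3) a → volume E ≤ volume (ball x₀ δ) →
        ∫⁻ x in E, ‖u s x‖ₑ ≤ ENNReal.ofReal (Φ s)) →
      ∃ T : Set E3, MeasurableSet T ∧ T ⊆ ball (0 : E3) a ∧
        volume (ball x₀ δ) ≤ volume T + ENNReal.ofReal ((∫ s in Set.Icc t₁ t₀, Φ s) / (a / 2)) ∧
        ∀ x ∈ T,
          w ^ 2 * Real.exp (-(2 * ∫ s in Set.Ioo t₁ t₀, Λ s)) * ((-t₀) / (-t₁)) ^ (2 * K) ≤ ‖curl (u t₁) x‖ ^ 2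

/-! ## Registered stub signatures -/

/-- Signature of `stub_anchoredFloorTransport` (C1, size M+/L−; the NEW lemma of the line — kinematics + Grönwall, no gauges, NO global flow): on a classical far
past with a stretching budget `(K, Λ)`, `K ≥ 0`, floor blobs are ANCHORED.  Proof (rev3, local flow only): fix `t₁ < t₀ < T₁`, the blob `B = B(x₀,δ) ⊆ B(0,a/2)`.  For
`s ∈ [t₁,t₀]` run the tree's GLOBAL flow kit on the CUTOFF FIELD `ũ := ψ·u` (`ψ` a smooth bump, `= 1` on `B(0,a)`, supported in `B(0,2a)`): `ũ` is jointly smooth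
(`IsSmoothSpaceTimeOn`) and `ODE.IsUniformlyLipschitzOn ũ (Icc t₁ t₀)` (smooth on a compact set) — NOT divergence-free, and it need not be: `X := ODE.evolutionMap ũ t₀ ·`
is a global flow of diffeomorphisms (`ODE.IsUniformlyLipschitzOn.contDiff_evolutionMap`, `bijective_evolutionMap`) whose trajectories are `u`-trajectories WHILE INSIDE
`B(0,a)` (there `ũ = u`; no uniqueness argument is even needed — all statements below are about `X`).  Let `D_s := {ξ ∈ B : X(ξ,σ) ∈ B(0,a) for all σ ∈ [s,t₀]}` —
OPEN (`X` continuous, `[s,t₀]` compact), decreasing as `s ↓ t₁`.  JACOBIAN ONE on `D_s`: Liouville's formula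
`Literature.Analysis.FluidPDE.det_fderiv_evolutionMap_eq_exp_integral_divergence_of_mem` gives `det ∂_ξX(ξ,s) = exp ∫_{t₀}^{s} div ũ(σ, X(ξ,σ)) dσ = 1` for `ξ ∈ D_s`,
because `div ũ = ψ div u + ∇ψ·u = 0` on `B(0,a)`; hence (`MeasureTheory.lintegral_abs_det_fderiv_eq_addHaar_image`, `X(·,s)` injective) `E_s := X_s(D_s)` is OPEN,
`⊆ B(0,a)`, `|E_s| = |D_s| ≤ |B|`, and `∫_{D_s}|u(s,X(ξ,s))|dξ = ∫_{E_s}|u(s,y)|dy ≤ Φ(s)` (eviction hypothesis, USED ONLY AT THE SETS `E_s`).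
ESCAPE SET `Esc := B ∖ D_{t₁}`: for `ξ ∈ Esc` the (global, continuous) `X`-trajectory satisfies `‖X(ξ,σ)‖ ≥ a` for some `σ ∈ [t₁,t₀)`; let `s*(ξ)` be the last such
time; on `(s*,t₀]` it runs inside `B(0,a)` from norm `a` to norm `< a/2`, i.e. `ξ ∈ D_s` for all `s > s*` and
`a/2 ≤ ∫_{s*}^{t₀}|u(s,X(ξ,s))|ds`; integrating over `Esc` and exchanging (Tonelli on the open set `{(ξ,s) : ξ ∈ D_s}`): `(a/2)|Esc| ≤ ∫_{t₁}^{t₀}∫_{D_s}|u(s,X(ξ,s))|dξ ds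
≤ ∫_{t₁}^{t₀}Φ`.  AVATAR `T := X_{t₁}(D_{t₁}) ⊆ B(0,a)`, open, `|T| = |D_{t₁}| = |B| − |Esc|`.  FLOOR on `T`: along each trajectory `m(σ) = |curl u(σ,X(ξ,σ))|²` obeys
`m' = 2⟪∇u ω, ω⟫ ≤ 2(K/(−σ)+Λ)m` (vorticity equation along trajectories of a classical solution, as in the lead's `KelvinPhysical.norm_curl_sq_le_of_subunitVortexStretching`),
so `m(t₁) ≥ m(t₀)e^{−2∫Λ}((−t₀)/(−t₁))^{2K} ≥ w²·(…)` — along `X`-trajectories from `D_{t₁}`, which stay in `B(0,a)` where `Ẋ = ũ(X) = u(X)`, so the material derivative of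
`curl u` along them is the Euler one.  [cite: doi:10.1515/crelle.2008.016 (Crippa–De Lellis 2008), §2–3 no-escape / compressibility estimates — here for a
smooth field, elementary; MajdaBertozziCUP2002, §1.6 (1.51), §2.5 (2.115)–(2.117)] -/
def Sig.stub_anchoredFloorTransport : Prop :=
  ∀ (u : ℝ → E3 → E3) (p : ℝ → E3 → ℝ) (T₁ K : ℝ) (Λ : ℝ → ℝ),
    IsAnchorablePast u p T₁ → 0 ≤ K → HasStretchingBudget u T₁ K Λ → AnchoredFloorBlobs u T₁ K Λ

/-- Signature of `stub_anchoredStarvation` (C2, size M+): GIVEN anchored floor blobs, a member of the class (`0 < ρ ≤ 1/2`) on the stratum has an IRROTATIONAL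
far past `(−∞,T₁)`.  Proof: if `curl u(t₀) x₀ ≠ 0` for some `t₀ < T₁` (wlog `t₀ ≤ −1`: anchored floors propagate non-vanishing backward), continuity gives a blob
`B = B(x₀,δ)` with `|curl u(t₀)| ≥ w > 0`; `Λ₁ := ∫_{−∞}^{T₁}Λ`.  EVICTION BUDGET from the gauges: `ψ_a ∈ C_c^∞(B(0,2a))`, `ψ_a = 1` on `B(0,a)`, `|∇ψ_a| ≤ 2/a`;
for measurable `E ⊆ B(0,a)`, `|E| ≤ |B|`: `∫_E|u(s)| ≤ |B|^{5/6}‖ψ_a u(s)‖_{L⁶} ≤ |B|^{5/6} C_GNS ‖∇(ψ_a u(s))‖_{L²} =: Φ(s)` (Hölder + Gagliardo–Nirenberg–Sobolev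
`MeasureTheory.eLpNorm_le_eLpNorm_fderiv_of_eq`, `p = 2`, `n = 3`); `∫_{t₁}^{t₀}Φ ≤ |B|^{5/6} C_GNS [S^{1/2}(c(2a)^{1−ρ})^{1/2} + S·(2/a)(c(2a)^{1−2ρ})^{1/2}]`
(`S = t₀ − t₁ ≤ 4a² + t₀`; `E`-gauge window bound at scale `2a`, `A`-gauge slice bound `BackwardTools.lintegral_ball_le_of_gaugeA` at scale `2a`); with the BULK
WINDOW `S_a := ε²|B|^{1/3}a^{1+ρ}/c` the first term is `ε'|B|a`, the second `O(a^{1/2})`, so `∫Φ ≤ (a/4)|B|` for `a ≥ a₀` and the avatar has `|T| ≥ |B|/2`; hence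
`∫_{B(0,a)}|curl u(t₁)|² ≥ (|B|/2) w² e^{−2Λ₁}(−t₀)^{2K}(−t₁)^{−2K}` for `t₁ ∈ (t₀−S_a,t₀)`; integrate in `t₁`: `≥ C (S_a^{1−2K} − (−t₀)^{1−2K})/(1−2K)` (`2K < 2/3`),
against `≤ 16 c a^{1−ρ}` (`CasimirFloorEndgameTools.lintegral_window_sq_curl_le`); the race `(1+ρ)(1−2K) > 1−ρ ⇔ K < anchoredThreshold ρ` (`exponent_race`) is a
contradiction as `a → ∞`.  [cite: CaffarelliKohnNirenberg1982, §2; doi:10.1515/crelle.2008.016] -/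
def Sig.stub_anchoredStarvation : Prop :=
  ∀ ρ : ℝ, 0 < ρ → ρ ≤ 1 / 2 → ∀ (u : ℝ → E3 → E3) (p : ℝ → E3 → ℝ) (H : ℝ → E3 → E3 →L[ℝ] E3) (c : ℝ≥0),
    InClass ρ u p H c → ∀ (T₁ K : ℝ) (Λ : ℝ → ℝ), IsAnchorablePast u p T₁ → 0 ≤ K →
      K < anchoredThreshold ρ → HasStretchingBudget u T₁ K Λ → AnchoredFloorBlobs u T₁ K Λ →
        ∀ τ : ℝ, τ < T₁ → ∀ x : E3, curl (u τ) x = 0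

/-- Signature of `stub_anchoredRest` (C3, OPEN, crux-sized — NOT claimed by this line): in the window `0 < ρ ≤ 1/2`, members OUTSIDE the stratum
(weak = non-classical; or classical with stretching budget above `K₂(ρ)/(−τ)` on every far past) are trivial. -/
def Sig.stub_anchoredRest : Prop :=
  ∀ ρ : ℝ, 0 < ρ → ρ ≤ 1 / 2 → ∀ (u : ℝ → E3 → E3) (p : ℝ → E3 → ℝ) (H : ℝ → E3 → E3 →L[ℝ] E3) (c : ℝ≥0),
    InClass ρ u p H c → ¬ IsAnchoredBudgeted ρ u p → VanishesAE u

/-! ## Stubs -/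

/-- STUB C1 — **FILLED BY NAME** (LANDED p631965 `AnchoredBudget.anchoredFloorTransport_rev3`, rev3 clause-free text, δ-unfolded verbatim;
`Theorems/EulerZoomLiouvillePowerGaugeEulerLiouvilleAnchoredBudgetLocalFloor.lean`, ns-sfl-p1 g4). -/
theorem stub_anchoredFloorTransport : Sig.stub_anchoredFloorTransport :=
  Summit.NavierStokesRegularity.NavierStokesRegularity.Theorems.PowerGaugeEulerLiouville.AnchoredBudget.anchoredFloorTransport_rev3

/-- STUB C2 — **FILLED BY NAME** (LANDED p629964 `AnchoredBudget.anchoredStarvation`, δ-unfolded verbatim;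
`Theorems/EulerZoomLiouvillePowerGaugeEulerLiouvilleAnchoredBudgetStarvation.lean`, ns-ezl-w2 g2). -/
theorem stub_anchoredStarvation : Sig.stub_anchoredStarvation :=
  Summit.NavierStokesRegularity.NavierStokesRegularity.Theorems.PowerGaugeEulerLiouville.AnchoredBudget.anchoredStarvation

/-- STUB C3 [OPEN residue, not claimed — the ONLY `sorry` of this file since rev5]. -/
theorem stub_anchoredRest : Sig.stub_anchoredRest := by
  sorry

/-! ## Sanity checks on the stratum arithmetic (kernel-checked) -/

/-- The bulk threshold is positive exactly when `ρ > 0` (for `ρ > −1`): the stratum is non-empty-by-arithmetic in the WHOLE window `0 < ρ ≤ 1/2`. -/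
theorem threshold_pos_iff {ρ : ℝ} (hρ : -1 < ρ) : 0 < anchoredThreshold ρ ↔ 0 < ρ := by
  unfold anchoredThreshold
  have h : (0 : ℝ) < 1 + ρ := by linarith
  rw [div_pos_iff_of_pos_right h]

/-- At the energy endpoint `ρ = 1/2` the bulk threshold is `1/3` (the envelope line reaches `3/8` there under a sub-parabolic drift, `1/4` under bounded velocity;
the lead's Type-I-gradient filler `1`). -/
example : anchoredThreshold (1 / 2) = 1 / 3 := by
  unfold anchoredThreshold; norm_num

/-- In the window `ρ ≤ 1/2` the bulk threshold never exceeds `1/3`. -/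
theorem threshold_le_third {ρ : ℝ} (hρ : -1 < ρ) (hρ2 : ρ ≤ 1 / 2) : anchoredThreshold ρ ≤ 1 / 3 := by
  unfold anchoredThreshold
  rw [div_le_iff₀ (by linarith : (0 : ℝ) < 1 + ρ)]
  linarith

/-- A sub-parabolic drift envelope (`κ ≥ 1/2`, sibling `stretching-budget`) is STRONGER: `K₂(ρ) < (1+ρ)/4` for `ρ > −1`, `ρ ≠ 1`. -/
theorem threshold_lt_envelope {ρ : ℝ} (hρ : -1 < ρ) (hρ1 : ρ ≠ 1) : anchoredThreshold ρ < (1 + ρ) / 4 := by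
  unfold anchoredThreshold
  rw [div_lt_iff₀ (by linarith : (0 : ℝ) < 1 + ρ)]
  have h : (0 : ℝ) < (1 - ρ) ^ 2 := by positivity
  nlinarith [h]

/-- But anchoring BEATS bounded velocity: the sibling's drift-branch threshold at `κ = 0` is `ρ/2 < ρ/(1+ρ)` for `0 < ρ < 1`. -/
theorem boundedVelocity_lt_threshold {ρ : ℝ} (hρ : 0 < ρ) (hρ1 : ρ < 1) : ρ / 2 < anchoredThreshold ρ := by
  unfold anchoredThreshold
  rw [lt_div_iff₀ (by linarith : (0 : ℝ) < 1 + ρ)]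
  nlinarith

/-- The window comparison behind the previous lemma: the GNS bulk window `a^{1+ρ}` beats the drift window `a^{1/(1−κ)}` iff `κ < ρ/(1+ρ)` (`κ < 1`, `ρ > −1`). -/
theorem anchor_beats_drift_iff {ρ κ : ℝ} (hκ : κ < 1) (hρ : -1 < ρ) :
    1 / (1 - κ) < 1 + ρ ↔ κ < anchoredThreshold ρ := by
  unfold anchoredThreshold
  rw [div_lt_iff₀ (by linarith : (0 : ℝ) < 1 - κ), lt_div_iff₀ (by linarith : (0 : ℝ) < 1 + ρ)]
  constructor <;> intro h <;> nlinarith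

/-- The exponent race behind C2: `(1+ρ)(1−2K) > 1−ρ ↔ K < K₂(ρ)` (for `ρ > −1`). -/
theorem exponent_race {ρ K : ℝ} (hρ : -1 < ρ) :
    1 - ρ < (1 + ρ) * (1 - 2 * K) ↔ K < anchoredThreshold ρ := by
  unfold anchoredThreshold
  rw [lt_div_iff₀ (by linarith : (0 : ℝ) < 1 + ρ)]
  constructor <;> intro h' <;> nlinarith

/-- The two window exponents add up: the GNS term `(S·c·a^{1−ρ})^{1/2}` with `S ≍ a^{1+ρ}` is `≍ a` — the distance to be travelled (`(1+ρ) + (1−ρ) = 2`). -/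
example (ρ : ℝ) : ((1 + ρ) + (1 - ρ)) / 2 = 1 := by ring

/-! ## Composition -/

/-- **Composition (kernel-checked, no sorry of its own): the three stubs give the crux BY NAME.**  The irrotational far past produced by
C1+C2 is closed by the lead's LANDED filler `PastIrrotational.ae_eq_zero_of_gauge_of_pastIrrotational`; `ρ > 1/2` is the landed
`powerGaugeEulerLiouville_largeRho`. -/
theorem PowerGaugeEulerLiouville_of :
    Sig.stub_anchoredFloorTransport → Sig.stub_anchoredStarvation → Sig.stub_anchoredRest →
      Summit.NavierStokesRegularity.NavierStokesRegularity.Theses.EulerZoomLiouville.PowerGaugeEulerLiouville := by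
  intro h1 h2 h3 ρ hρ u p H c hsw hH hc
  by_cases hhalf : 1 / 2 < ρ
  · exact
      Summit.NavierStokesRegularity.NavierStokesRegularity.Theorems.PowerGaugeEulerLiouville.powerGaugeEulerLiouville_largeRho
        ρ hhalf u p H c hsw hH hc
  · have hρ2 : ρ ≤ 1 / 2 := not_lt.mp hhalf
    by_cases hS : IsAnchoredBudgeted ρ u p
    · obtain ⟨T₁, K, Λ, hP, hK0, hK, hB⟩ := hS
      have hcurl : ∀ τ : ℝ, τ < T₁ → ∀ x : E3, curl (u τ) x = 0 :=
        h2 ρ hρ hρ2 u p H c ⟨hsw, hH, hc⟩ T₁ K Λ hP hK0 hK hB (h1 u p T₁ K Λ hP hK0 hB)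
      have hcl : IsClassicalEulerSolutionOn (Set.Iio 0) 0 u p := hP.1
      have hT₁ : T₁ ≤ 0 := hP.2
      have hmem : ∀ τ : ℝ, τ < T₁ → τ ∈ Set.Iio (0 : ℝ) := fun τ hτ => lt_of_lt_of_le hτ hT₁
      exact
        Summit.NavierStokesRegularity.NavierStokesRegularity.Theorems.PowerGaugeEulerLiouville.PastIrrotational.ae_eq_zero_of_gauge_of_pastIrrotational
          hρ hρ2 hsw hH hc hT₁ (fun τ hτ => (hcl.contDiff_velocity (hmem τ hτ)).of_le (by norm_cast))
          (fun τ hτ => hcl.divFree τ (hmem τ hτ)) hcurl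
    · exact h3 ρ hρ hρ2 u p H c ⟨hsw, hH, hc⟩ hS

/-! ## The quotable member (V37 P2): `K = 0` -/

/-- **The `K = 0` corollary, kernel-checked modulo C1 + C2 only (no residue):** for EVERY `ρ > 0`, a CLASSICAL member of the power-gauged class with a
far past `(−∞,T₁)` along which `|ω| e^{−∫Λ}` is non-increasing FORWARD on every trajectory (stretching budget `(0, Λ)`, `Λ ≥ 0` integrable — i.e.
`⟪∇u ω, ω⟫ ≤ Λ(τ)|ω|²`) vanishes a.e.  This is the natural first prover target after C1/C2 and the theorem readers should quote. -/
theorem anchoredBudget_K0_of (h1 : Sig.stub_anchoredFloorTransport) (h2 : Sig.stub_anchoredStarvation) :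
    ∀ ρ : ℝ, 0 < ρ → ∀ (u : ℝ → E3 → E3) (p : ℝ → E3 → ℝ) (H : ℝ → E3 → E3 →L[ℝ] E3) (c : ℝ≥0),
      InClass ρ u p H c → (∃ T₁ : ℝ, ∃ Λ : ℝ → ℝ, IsAnchorablePast u p T₁ ∧ HasStretchingBudget u T₁ 0 Λ) → VanishesAE u := by
  intro ρ hρ u p H c hcls hK0
  obtain ⟨hsw, hH, hc⟩ := hcls
  by_cases hhalf : 1 / 2 < ρ
  · exact
      Summit.NavierStokesRegularity.NavierStokesRegularity.Theorems.PowerGaugeEulerLiouville.powerGaugeEulerLiouville_largeRho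
        ρ hhalf u p H c hsw hH hc
  · have hρ2 : ρ ≤ 1 / 2 := not_lt.mp hhalf
    obtain ⟨T₁, Λ, hP, hB⟩ := hK0
    have hthr : (0 : ℝ) < anchoredThreshold ρ := (threshold_pos_iff (by linarith)).mpr hρ
    have hcurl : ∀ τ : ℝ, τ < T₁ → ∀ x : E3, curl (u τ) x = 0 :=
      h2 ρ hρ hρ2 u p H c ⟨hsw, hH, hc⟩ T₁ 0 Λ hP le_rfl hthr hB (h1 u p T₁ 0 Λ hP le_rfl hB)
    have hcl : IsClassicalEulerSolutionOn (Set.Iio 0) 0 u p := hP.1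
    have hT₁ : T₁ ≤ 0 := hP.2
    have hmem : ∀ τ : ℝ, τ < T₁ → τ ∈ Set.Iio (0 : ℝ) := fun τ hτ => lt_of_lt_of_le hτ hT₁
    exact
      Summit.NavierStokesRegularity.NavierStokesRegularity.Theorems.PowerGaugeEulerLiouville.PastIrrotational.ae_eq_zero_of_gauge_of_pastIrrotational
        hρ hρ2 hsw hH hc hT₁ (fun τ hτ => (hcl.contDiff_velocity (hmem τ hτ)).of_le (by norm_cast))
        (fun τ hτ => hcl.divFree τ (hmem τ hτ)) hcurl

/-- **«BKM at −∞» (corollary of the `K = 0` member, kernel-checked modulo C1 + C2 only):** for every `ρ > 0`, a CLASSICAL member of the power-gauged class with a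
far past `(−∞,T₁)` whose LIPSCHITZ MODULUS IS INTEGRABLE AT `−∞` — `‖∇u(τ)‖_∞ ≤ Λ(τ)`, `Λ ≥ 0`, `∫_{(−∞,T₁)} Λ < ∞` — vanishes a.e.
(`⟪∇u ω, ω⟫ ≤ ‖∇u‖|ω|² ≤ Λ|ω|²` is the budget `(0, Λ)`).  NO fading of the vorticity is assumed: compare the lead's LANDED `VorticityBirth` filler
(`IsClassicalVorticityTame`, 2nd disjunct), which needs `e^{∫_s^T Λ}·sup|curl u(s)| → 0` along `s → −∞`; here the permanent `K = 0` floor is killed by the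
GAUGES through anchoring (C1) + enstrophy starvation (C2), not by smallness at birth. -/
theorem anchoredBudget_integrableLipschitz_of (h1 : Sig.stub_anchoredFloorTransport) (h2 : Sig.stub_anchoredStarvation) :
    ∀ ρ : ℝ, 0 < ρ → ∀ (u : ℝ → E3 → E3) (p : ℝ → E3 → ℝ) (H : ℝ → E3 → E3 →L[ℝ] E3) (c : ℝ≥0),
      InClass ρ u p H c → ∀ (T₁ : ℝ) (Λ : ℝ → ℝ), IsAnchorablePast u p T₁ → IntegrableOn Λ (Set.Iio T₁) → (∀ τ : ℝ, 0 ≤ Λ τ) →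
        (∀ τ : ℝ, τ < T₁ → ∀ x : E3, ‖fderiv ℝ (u τ) x‖ ≤ Λ τ) → VanishesAE u := by
  intro ρ hρ u p H c hcls T₁ Λ hP hΛi hΛ0 hLip
  refine anchoredBudget_K0_of h1 h2 ρ hρ u p H c hcls ⟨T₁, Λ, hP, hΛi, hΛ0, ?_⟩
  intro τ hτ x
  have hcs : ⟪fderiv ℝ (u τ) x (curl (u τ) x), curl (u τ) x⟫ ≤
      ‖fderiv ℝ (u τ) x (curl (u τ) x)‖ * ‖curl (u τ) x‖ := real_inner_le_norm _ _
  have hop : ‖fderiv ℝ (u τ) x (curl (u τ) x)‖ ≤ ‖fderiv ℝ (u τ) x‖ * ‖curl (u τ) x‖ :=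
    ContinuousLinearMap.le_opNorm _ _
  have hn : 0 ≤ ‖curl (u τ) x‖ := norm_nonneg _
  calc ⟪fderiv ℝ (u τ) x (curl (u τ) x), curl (u τ) x⟫
      ≤ ‖fderiv ℝ (u τ) x‖ * ‖curl (u τ) x‖ * ‖curl (u τ) x‖ := hcs.trans (by gcongr)
    _ ≤ Λ τ * ‖curl (u τ) x‖ * ‖curl (u τ) x‖ := by gcongr; exact hLip τ hτ x
    _ = (0 / (-τ) + Λ τ) * ‖curl (u τ) x‖ ^ 2 := by rw [zero_div, zero_add]; ring


/-! ## rev5: UNCONDITIONAL forms (C1, C2 filled by name; no sorry in the cone of anything below) -/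

/-- **The crux modulo the residue ALONE** (kernel-checked from landed theorems): `Sig.stub_anchoredRest → PowerGaugeEulerLiouville`. -/
theorem PowerGaugeEulerLiouville_of_anchoredRest :
    Sig.stub_anchoredRest →
      Summit.NavierStokesRegularity.NavierStokesRegularity.Theses.EulerZoomLiouville.PowerGaugeEulerLiouville :=
  PowerGaugeEulerLiouville_of stub_anchoredFloorTransport stub_anchoredStarvation

/-- **THE STRATUM THEOREM, unconditional** (this file's composition with C1/C2 filled): for `0 < ρ`, a member of the class on the stratum
`IsAnchoredBudgeted ρ` vanishes a.e.  (The tree's own statement: `AnchoredBudget.anchoredBudgeted_ae_eq_zero_rev3`, p632310 — cited in the next decl.) -/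
theorem anchoredBudgeted_vanishes :
    ∀ ρ : ℝ, 0 < ρ → ∀ (u : ℝ → E3 → E3) (p : ℝ → E3 → ℝ) (H : ℝ → E3 → E3 →L[ℝ] E3) (c : ℝ≥0),
      InClass ρ u p H c → IsAnchoredBudgeted ρ u p → VanishesAE u :=
  fun ρ hρ u p H c hin hS =>
    Summit.NavierStokesRegularity.NavierStokesRegularity.Theorems.PowerGaugeEulerLiouville.AnchoredBudget.anchoredBudgeted_ae_eq_zero_rev3 ρ hρ u p H c hin hS

/-- **The `K = 0` member, unconditional.** -/
theorem anchoredBudget_K0 :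
    ∀ ρ : ℝ, 0 < ρ → ∀ (u : ℝ → E3 → E3) (p : ℝ → E3 → ℝ) (H : ℝ → E3 → E3 →L[ℝ] E3) (c : ℝ≥0),
      InClass ρ u p H c → (∃ T₁ : ℝ, ∃ Λ : ℝ → ℝ, IsAnchorablePast u p T₁ ∧ HasStretchingBudget u T₁ 0 Λ) → VanishesAE u :=
  anchoredBudget_K0_of stub_anchoredFloorTransport stub_anchoredStarvation

/-- **«BKM at −∞», unconditional:** a classical member whose Lipschitz modulus is integrable at `−∞` on some far past vanishes a.e.
(The tree's own statement: `AnchoredBudget.integrableLipschitz_ae_eq_zero`.) -/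
theorem anchoredBudget_integrableLipschitz :
    ∀ ρ : ℝ, 0 < ρ → ∀ (u : ℝ → E3 → E3) (p : ℝ → E3 → ℝ) (H : ℝ → E3 → E3 →L[ℝ] E3) (c : ℝ≥0),
      InClass ρ u p H c → ∀ (T₁ : ℝ) (Λ : ℝ → ℝ), IsAnchorablePast u p T₁ → IntegrableOn Λ (Set.Iio T₁) → (∀ τ : ℝ, 0 ≤ Λ τ) →
        (∀ τ : ℝ, τ < T₁ → ∀ x : E3, ‖fderiv ℝ (u τ) x‖ ≤ Λ τ) → VanishesAE u :=
  anchoredBudget_integrableLipschitz_of stub_anchoredFloorTransport stub_anchoredStarvation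

/-- Cross-check: the tree's statement of «BKM at −∞» is in scope. -/
example := @Summit.NavierStokesRegularity.NavierStokesRegularity.Theorems.PowerGaugeEulerLiouville.AnchoredBudget.integrableLipschitz_ae_eq_zero

end Summit.NavierStokesRegularity.NavierStokesRegularity.Cruxes.PowerGaugeEulerLiouville.AnchoredBudget
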